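import Mathlib.Topology.Algebra.Category.ProfiniteGrp.Basic
import Mathlib.GroupTheory.Index
import Literature.AnabelianGeometry.AbsoluteAnabelian.FundamentalExtension
import Literature.AnabelianGeometry.AbsoluteAnabelian.AbsTopIII.KummerFaithful
import Literature.AnabelianGeometry.AbsoluteAnabelian.AbsTopII.EllipticAdmissible
import Literature.AnabelianGeometry.AbsoluteAnabelian.AbsTopII.EllipticCuspidalization
import Literature.AlgebraicGeometry.Frobenioids.Categories
import HarnessLib

/-!
# [AbsTopII] §3: profinite Belyi cuspidalization (Example 3.6, Corollaries 3.7/3.8, Remarks 3.7.1–2)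

S. Mochizuki, *Topics in Absolute Anabelian Geometry II: Decomposition Groups and Endomorphisms*
[AbsTopII], §3 "Elliptic and Belyi Cuspidalizations", pp. 71–74.  Page locators `p.N` are the PDF
pages of the author's manuscript (lit key `paper:url-585b8d0ad0d9`, 76 pp.); journal pagination
not held.  Bib key `MochizukiAbsTopII2013`.  Census nodes typed here: AbsTopII:Cor3.7(i)(ii)(iii)
(= the printed clauses (a)(b)(c)); Ex 3.6, Rmk 3.3.1 / 3.7.1 / 3.7.2, Cor 3.8 are not census
nodes but are typed/recorded because [AbsTopIII] Thm 1.9 (a) consumes exactly them (L4 LC1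
chain, `plan/L4/LC1-CHAIN.md` rows L2c, M4).

## How the items are typed (cell ruling θ)

* Shape (1), OUTPUT over an abstract extension `E` (the tree's `FundamentalExtension`):
  `Cuspidalization E` (an extension `Π_{U_X} ↠ G` with a surjection onto `Π` over `G` — statement
  core drafted by abc-iut-L4-t4, adopted per ruling μ) and `BelyiCuspidalization E` = what the
  group-theoretic algorithm (a)(b)(c) of Cor 3.7 constructs for ONE open `U_X`, with the printed
  group-theoretic properties as fields (the `Π`-chain of type `⋏, ⋎, •, …, •, ⋏, •, …, •, ⋎` of
  Example 3.6 (ii), `Π_U ↠ Π_V`, the unique outer lifting and the `⋊^out`-reconstruction of (b),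
  the cusps of (c)).
* Shape (M), COMPARISON over `BelyiCurveModel` (= `IsogenyModel` + real base fields with
  `G_k ≅ Gal(k̄/k)` + the nonempty open subschemes `U_X ⊆ X` defined over a number field with their
  natural surjections `π₁(U_X) ↠ π₁(X)` and cusps; no instance in the tree; TODO-merge
  abc-iut-L4-t1 `CurveModel`, whose `IsCofiniteOpen`/`res` play the role of `Open`/`cuspOf` over
  one base field): `Cor_3_7` (existence: every `Π_{U_X} ↠ Π_X` is computed by some
  `BelyiCuspidalization`) and `Cor_3_8` (the bi-anabelian form).
* HYPOTHESES.  Cor 3.7 assumes "`𝒟` chain-full, rel-isom-DGC holds" ([AbsTopI] Def 4.6),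
  "extension of GSAFG-type with partial construction data `(k, X, Σ)`, scheme-theoretic envelope
  `α` an isomorphism" ([AbsTopI] Def 2.1), "`G` slim", "for some `l ∈ Σ` the cyclotomic character
  `G → ℤ_l^×` has open image".  Remark 3.7.1 = Remark 3.3.1 for Cor 3.7: the `𝒟`-hypothesis is
  MET by `𝒟 :=` (hyperbolic orbicurves) × (generalized sub-`p`-adic fields) × (`Σ ∋ p`) "[cf.
  [AbsTopI] Example 4.8 (i)]".  The statements below are typed in exactly this INSTANTIATED form
  — the one [AbsTopIII] Thm 1.9 (a) uses: base field generalized sub-`p`-adic (the tree's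
  `AbsTopIII.IsGeneralizedSubpadicFor`, abc-iut-L4-t1), `Σ` = all primes and `Π = π₁(X)` (so the
  GSAFG/envelope data are the identity), `G` slim (tree `IsSlimGroup`), cyclotomic character with
  open image (tree `AbsTopIII.cyclotomicChar`).  -- TODO(general form): the `𝒟`-parametrised
  statement over abc-iut-L4-t13's `RelativeAnabelianDatum.RelIsomGC` / `IsChainFull`
  (RelativeGrothendieckConjecture.lean, staged) and abc-iut-L4-t4's `PiChain`/`IsEtLocObj`
  ([AbsTopI] Def 4.2, Chains.lean, staged) once those build — TODO-import.

Deliberately NOT here: Cor 3.4 (elliptic comparison form; needs `N`-torsion opens in the model);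
the Belyi maps themselves (Ex 3.6 (i) "[Belyi], [Mzk7]" — only their type-chains).
HONEST FRAMING: typed ≠ discharged; nothing here takes a side on [IUTchIII] Cor 3.12.
-/

open CategoryTheory Topology
open scoped Pointwise

universe u

namespace Literature.AnabelianGeometry.AbsoluteAnabelian.AbsTopII

open Literature.AlgebraicGeometry.Frobenioids (IsSlimGroup)
open Literature.AnabelianGeometry.EtaleTheta (TopOut contMulAut)
open FundamentalExtension

/-! ### Example 3.6: the Belyi type-chains -/

/-- **Example 3.6 (i)** p. 71: for a Belyi map `β : W → P` (`W ↪ U ↪ V`, `P` = the projective line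
minus three points) the chain `P ⇝ W ⇝ W_n ⇝ ⋯ ⇝ W_1 = U ⇝ U_m ⇝ ⋯ ⇝ U_1 = V` "whose associated
type-chain is `⋏, •, …, •` [i.e., a finite étale covering, followed by `n + m`
de-cuspidalizations]". [cite: MochizukiAbsTopII2013, Ex 3.6 (i) p.71] -/
def Ex_3_6_i_typeChain (n m : ℕ) : List ElementaryOp :=
  ElementaryOp.cov :: List.replicate (n + m) ElementaryOp.decusp

/-- **Example 3.6 (ii)** p. 72: appending `V → X` (⋏), `V → Q` (⋎), the de-cuspidalizations
`Q ↪ Q_l ↪ ⋯ ↪ Q_1 = P` on the left and `V → X` (⋎) on the right gives the type-chain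
"`⋏, ⋎, •, …, •, ⋏, •, …, •, ⋎`" — the one quoted in Cor 3.7 (a).
[cite: MochizukiAbsTopII2013, Ex 3.6 (ii) p.72] -/
def Ex_3_6_ii_typeChain (l n m : ℕ) : List ElementaryOp :=
  [ElementaryOp.cov, ElementaryOp.quot] ++ List.replicate l ElementaryOp.decusp ++
    Ex_3_6_i_typeChain n m ++ [ElementaryOp.quot]

/-- Length of the chain of Ex 3.6 (i): `1 + (n + m)`. [cite: MochizukiAbsTopII2013, Ex 3.6 (i) p.71] -/
theorem length_Ex_3_6_i_typeChain (n m : ℕ) : (Ex_3_6_i_typeChain n m).length = 1 + (n + m) := by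
  simp [Ex_3_6_i_typeChain, Nat.add_comm]

/-- Length of the chain of Ex 3.6 (ii): `l + n + m + 4`. [cite: MochizukiAbsTopII2013, Ex 3.6 (ii) p.72] -/
theorem length_Ex_3_6_ii_typeChain (l n m : ℕ) :
    (Ex_3_6_ii_typeChain l n m).length = l + n + m + 4 := by
  simp [Ex_3_6_ii_typeChain, Ex_3_6_i_typeChain]
  omega

/-! ### Continuous outer liftings (Cor 3.7 (b)) -/

section TopOuterLifting

variable {P A : Type u} [Group P] [TopologicalSpace P] [Group A]

/-- CONTINUOUS version of `IsOuterLifting` (EllipticCuspidalization.lean): for `f : P → A` (think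
`Π_U → Π`, image `Π_V`) a homomorphism `ρ : A →* Out(P)` INTO THE OUTER AUTOMORPHISM GROUP OF THE
TOPOLOGICAL GROUP `P` (bi-continuous automorphisms modulo inner ones — the tree's
`EtaleTheta.TopOut`, as in §0 p. 5 "`Aut(G)`, `Out(G)`" for profinite `G`) is an *outer lifting
along `f`* of the conjugation action when every `ρ(g)` is represented by a bi-continuous
automorphism `a` with `f (a x) = g · f(x) · g⁻¹` ("the unique lifting [relative to `Π_U ↠ Π_V`] of
the outer action of the finite group `Π/Π_V` on `Π_V` to a group of outer automorphisms of `Π_U`",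
Cor 3.7 (b) p. 73).  (For topologically finitely generated profinite `P` every automorphism is
continuous — Nikolov–Segal — so this agrees with the abstract version there; the continuous form is
the printed one.)
[cite: MochizukiAbsTopII2013, Cor 3.7 (b) p.73] -/
def IsTopOuterLifting (f : P →* A) (ρ : A →* TopOut P) : Prop :=
  ∀ g : A, ∃ a : contMulAut P, TopOut.mk P a = ρ g ∧ ∀ x : P, f ((a : MulAut P) x) = g * f x * g⁻¹

end TopOuterLifting

/-! ### Cuspidalizations of an abstract extension -/

/-- A *cuspidalization* of the extension `E` (= `Π ↠ G`): an extension `ext` (= `Π_{U_X} ↠ G`)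
with a homomorphism `hom : ext ⟶ E` that is surjective on `Π` and bijective on `G` ("the natural
surjection `Π_{U_X} := π₁(U_X) ↠ π₁(X) ≅ Π` — i.e., 'cuspidalization' of `Π`", Cor 3.7 p. 73).
Statement core drafted by abc-iut-L4-t4 (staging/L4/L4-t4/Cuspidalization.lean), adopted here per
ruling μ. [cite: MochizukiAbsTopII2013, Cor 3.7 p.73] -/
structure Cuspidalization (E : FundamentalExtension.{u}) : Type (u + 1) where
  /-- the extension `1 → Δ_{U_X} → Π_{U_X} → G → 1` -/
  ext : FundamentalExtension.{u}
  /-- `Π_{U_X} ↠ Π` as a homomorphism of extensions -/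
  hom : ext ⟶ E
  /-- surjective on `Π` -/
  arith_surjective : Function.Surjective hom.arith
  /-- bijective on `G` (same base field) -/
  gal_bijective : Function.Bijective hom.gal

namespace Cuspidalization

variable {E : FundamentalExtension.{u}} (c : Cuspidalization E)

/-- Two cuspidalizations are *isomorphic over `Π`* when there is a bi-continuous isomorphism of
the `Π_{U}`'s compatible with the surjections onto `Π` (the equivalence under which Cor 3.7 / 3.8
identify outputs; Cor 3.8: "compatible with `φ`, relative to the natural surjections").
[cite: MochizukiAbsTopII2013, Cor 3.8 p.74] -/
def IsoOver (c c' : Cuspidalization E) : Prop :=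
  ∃ β : c.ext.arith ≃ₜ* c'.ext.arith, ∀ x, c'.hom.arith (β x) = c.hom.arith x

/-- `IsoOver` is reflexive. [cite: MochizukiAbsTopII2013, Cor 3.8 p.74] -/
theorem IsoOver.refl (c : Cuspidalization E) : IsoOver c c := ⟨ContinuousMulEquiv.refl _, fun _ => rfl⟩

/-- `IsoOver` is symmetric. [cite: MochizukiAbsTopII2013, Cor 3.8 p.74] -/
theorem IsoOver.symm {c c' : Cuspidalization E} (h : IsoOver c c') : IsoOver c' c := by
  obtain ⟨β, hβ⟩ := h
  refine ⟨β.symm, fun x => ?_⟩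
  rw [← hβ (β.symm x), ContinuousMulEquiv.apply_symm_apply]

/-- The images in `Π` of the cuspidal decomposition groups of `Π_{U_X}`, as a set of subgroups
closed under the choice of conjugate upstairs (Cor 3.7 (c)). [cite: MochizukiAbsTopII2013, Cor 3.7 (c) p.73] -/
def decompositionImages (C : CuspidalData c.ext) : Set (Subgroup E.arith) :=
  {D | ∃ (x : C.Cusp) (g : c.ext.arith), D = (MulAut.conj g • C.Dcusp x).map c.hom.arith.toMonoidHom}

end Cuspidalization

/-! ### Corollary 3.7 (Profinite Belyi Cuspidalization I: Algorithms) — the output -/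

/-- **Corollary 3.7 (a)(b)(c)** pp. 72–73, OUTPUT STRUCTURE (shape (1)) over an abstract extension
`E` (= `Π ≅ π₁(X) ↠ G`) for ONE nonempty open subscheme `U_X ⊆ X` defined over a number field:
"(a) For some normal open subgroup `Π_V ⊆ Π` [...] there exists a [not necessarily unique]
`Π`-chain, which admits an entirely group-theoretic description, with associated type-chain
`⋏, ⋎, •, …, •, ⋏, •, …, •, ⋎` — cf. Example 3.6, (ii) — that admits a terminal isomorphism with the
trivial `Π`-chain such that if we write `U := V ×_X U_X`, `Π_U := Π_V ×_Π Π_{U_X}`, then the natural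
surjection `Π_U ↠ Π_V` may be recovered from the chain of •'s terminating at the second to last
group [...]. (b) The natural surjection `Π_{U_X} ↠ Π` may be recovered from `Π_U ↠ Π_V` by forming
the `⋊^out` with respect to the unique lifting [relative to `Π_U ↠ Π_V`] of the outer action of the
finite group `Π/Π_V` on `Π_V` to a group of outer automorphisms of `Π_U`. (c) The decomposition
groups of the closed points of `X` lying in the complement of `U_X` may be obtained as the images
via `Π_{U_X} ↠ Π` of the cuspidal decomposition groups of `Π_{U_X}`."  The `Π`-chain itself
([AbsTopI] Def 4.2 object of `Chain(Π)`) is recorded by its type-chain only — TODO-import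
abc-iut-L4-t4 `PiChain`. [cite: MochizukiAbsTopII2013, Cor 3.7 pp.72-73] -/
structure BelyiCuspidalization (E : FundamentalExtension.{u}) : Type (u + 1) where
  /-- (a) "some normal open subgroup `Π_V ⊆ Π`, which corresponds to a finite covering `V → X`" -/
  PiV : Subgroup E.arith
  /-- (a) `Π_V` is normal -/
  normal_PiV : PiV.Normal
  /-- (a) `Π_V` is open -/
  isOpen_PiV : IsOpen (PiV : Set E.arith)
  /-- (a) the numbers `l, n, m` of de-cuspidalizations in the `Π`-chain (Ex 3.6 (ii)) -/
  chainParams : ℕ × ℕ × ℕ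
  /-- (a) the extension `1 → Δ_U → Π_U → G_V → 1` of `U := V ×_X U_X` … -/
  cuspU : FundamentalExtension.{u}
  /-- (a) … with "the natural surjection `Π_U ↠ Π_V`", "recovered from the chain of •'s terminating
  at the second to last group" -/
  projU : cuspU ⟶ E
  /-- (a) `Π_U ↠ Π_V`: the image is `Π_V` … -/
  range_projU_arith : projU.arith.toMonoidHom.range = PiV
  /-- (a) … over `G_V = ` the image of `Π_V` in `G` -/
  range_projU_gal : projU.gal.toMonoidHom.range = PiV.map E.aug.toMonoidHom
  /-- (b) THE OUTPUT: the cuspidalization `Π_{U_X} ↠ Π` -/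
  cusp : Cuspidalization E
  /-- (a) "`Π_U := Π_V ×_Π Π_{U_X}`": the preimage of `Π_V` in `Π_{U_X}` is identified with `Π_U` … -/
  glue : ↥(PiV.comap cusp.hom.arith.toMonoidHom) ≃* cuspU.arith
  /-- … compatibly with the maps to `Π_V ⊆ Π` -/
  glue_comm : ∀ x : ↥(PiV.comap cusp.hom.arith.toMonoidHom),
    cusp.hom.arith x = projU.arith (glue x)
  /-- (b), uniqueness: an outer action of `Π` trivial on `Π_V` (i.e. of "the finite group `Π/Π_V`")
  on the topological group `Π_U` lifting the conjugation action on `Π_V` along `Π_U ↠ Π_V` is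
  UNIQUE -/
  lifting_unique : ∀ ρ ρ' : E.arith →* TopOut ↥(PiV.comap cusp.hom.arith.toMonoidHom),
    PiV ≤ ρ.ker → PiV ≤ ρ'.ker →
    IsTopOuterLifting (cusp.hom.arith.toMonoidHom.comp
      (PiV.comap cusp.hom.arith.toMonoidHom).subtype) ρ →
    IsTopOuterLifting (cusp.hom.arith.toMonoidHom.comp
      (PiV.comap cusp.hom.arith.toMonoidHom).subtype) ρ' → ρ = ρ'
  /-- (b), reconstruction "by forming the `⋊^out`": `Π_U` has trivial centre, so
  `Π_{U_X} = Π_U ⋊^out (Π/Π_V)` (`conjProdQuot_injective`, `mem_range_conjProdQuot_iff`) -/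
  center_PiU_eq_bot : Subgroup.center ↥(PiV.comap cusp.hom.arith.toMonoidHom) = ⊥
  /-- (c) the cusps of `U_X` with their decomposition groups in `Π_{U_X}` ("the cuspidal
  decomposition groups of `Π_{U_X}` [cf. [AbsTopI], Lemma 4.5, (v)]") -/
  cusps : CuspidalData cusp.ext

namespace BelyiCuspidalization

variable {E : FundamentalExtension.{u}} (B : BelyiCuspidalization E)

/-- `Π_U = Π_V ×_Π Π_{U_X} ⊆ Π_{U_X}` (Cor 3.7 (a)). [cite: MochizukiAbsTopII2013, Cor 3.7 (a) p.73] -/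
def PiU : Subgroup B.cusp.ext.arith := B.PiV.comap B.cusp.hom.arith.toMonoidHom

/-- The type-chain of the `Π`-chain of (a): `⋏, ⋎, •, …, •, ⋏, •, …, •, ⋎` (Ex 3.6 (ii)).
[cite: MochizukiAbsTopII2013, Cor 3.7 (a) p.73] -/
def typeChain : List ElementaryOp :=
  Ex_3_6_ii_typeChain B.chainParams.1 B.chainParams.2.1 B.chainParams.2.2

/-- **Cor 3.7 (c)** p. 73 (REAL on the output): the decomposition group in `Π` of a removed
closed point = the image of a cuspidal decomposition group of `Π_{U_X}`.
[cite: MochizukiAbsTopII2013, Cor 3.7 (c) p.73] -/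
def removedPointDecomposition (x : B.cusps.Cusp) : Subgroup E.arith :=
  (B.cusps.Dcusp x).map B.cusp.hom.arith.toMonoidHom

/-- `Π_U` is normal in `Π_{U_X}`. [cite: MochizukiAbsTopII2013, Cor 3.7 (a) p.73] -/
instance normal_PiU : B.PiU.Normal := by
  haveI := B.normal_PiV
  exact Subgroup.Normal.comap inferInstance _

/-- The kernel of `Π_{U_X} ↠ Π` lies in `Π_U`. [cite: MochizukiAbsTopII2013, Cor 3.7 (b) p.73] -/
theorem ker_le_PiU : B.cusp.hom.arith.toMonoidHom.ker ≤ B.PiU := by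
  intro x hx
  rw [MonoidHom.mem_ker] at hx
  change B.cusp.hom.arith.toMonoidHom x ∈ B.PiV
  rw [hx]
  exact one_mem _

/-- (b) made explicit (PROVED from `center_PiU_eq_bot`): `Π_{U_X} ↪ Aut(Π_U) × Π_{U_X}/Π_U` with
image `Π_U ⋊^out (Π_{U_X}/Π_U)`. [cite: MochizukiAbsTopII2013, Cor 3.7 (b) p.73] -/
theorem conjProdQuot_PiU_injective : Function.Injective (conjProdQuot B.PiU) :=
  conjProdQuot_injective B.PiU B.center_PiU_eq_bot

/-- Each removed-point decomposition group belongs to `decompositionImages` of the output.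
[cite: MochizukiAbsTopII2013, Cor 3.7 (c) p.73] -/
theorem removedPointDecomposition_mem (x : B.cusps.Cusp) :
    B.removedPointDecomposition x ∈ B.cusp.decompositionImages B.cusps :=
  ⟨x, 1, by simp [removedPointDecomposition]⟩

end BelyiCuspidalization

/-! ### The model side: curves with base fields and NF-rational opens (shape (M)) -/

/-- MODEL INTERFACE for Cor 3.7/3.8 (no instance in the tree; TODO-merge abc-iut-L4-t1
`CurveModel`): an `IsogenyModel` together with, for each curve `X`, its base field `k` as a real
field of characteristic zero with `G ≅ Gal(k̄/k)` ("`G ≅ Gal(k̃/k)`", Cor 3.7 p. 72, `k̃ = k̄` as `α`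
is an isomorphism), the nonempty open subschemes `U_X ⊆ X` defined over a number field ("for every
nonempty open subscheme `U_X ⊆ X` defined over a number field", p. 73) with "the natural surjection
`Π_{U_X} := π₁(U_X) ↠ π₁(X)`" and the cusps of `U_X`. [cite: MochizukiAbsTopII2013, Cor 3.7 p.73] -/
structure BelyiCurveModel : Type (u + 1) extends IsogenyModel.{u} where
  /-- the base field `k` of `X` -/
  base : Curve → Type u
  /-- `k` is a field … -/
  instField : ∀ X, Field (base X)
  /-- … of characteristic zero -/
  instCharZero : ∀ X, CharZero (base X)
  /-- `G = Gal(k̄/k)` -/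
  galIso : ∀ X, (ext X).gal ≅ absoluteGaloisGrp (base X)
  /-- the nonempty open subschemes `U_X ⊆ X` defined over a number field -/
  Open : Curve → Type u
  /-- `π₁(U_X) ↠ π₁(X)` -/
  cuspOf : ∀ {X : Curve}, Open X → Cuspidalization (ext X)
  /-- the cusps of `U_X` with their decomposition groups in `π₁(U_X)` -/
  cuspsOf : ∀ {X : Curve} (U : Open X), CuspidalData (cuspOf U).ext

namespace BelyiCurveModel

variable (M : BelyiCurveModel.{u})

/-- The base field of a curve of the model is a field (the model's own bundled instance; no
Mathlib instance is overridden). [cite: MochizukiAbsTopII2013, Cor 3.7 p.72] -/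
instance instFieldBase (X : M.Curve) : Field (M.base X) := M.instField X

/-- The base field of a curve of the model has characteristic zero (bundled instance).
[cite: MochizukiAbsTopII2013, Cor 3.7 p.72] -/
instance instCharZeroBase (X : M.Curve) : CharZero (M.base X) := M.instCharZero X

/-- The HYPOTHESES of Cor 3.7 on `(X, k)` in the instantiated form of Rmk 3.7.1 / Rmk 3.3.1 /
[AbsTopI] Ex 4.8 (i) (see the module docstring): `X` of strictly Belyi type (Def 3.5), `k`
generalized sub-`p`-adic for some `p` (`𝒟`-membership with `Σ` = all primes `∋ p`), `G` slim,
and "for some `l ∈ Σ`, the cyclotomic character `G → ℤ_l^×` has open image".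
[cite: MochizukiAbsTopII2013, Rmk 3.7.1 p.73] -/
structure IsCor37Input (X : M.Curve) : Prop where
  /-- "`X` is a hyperbolic orbicurve of strictly Belyi type" -/
  strictlyBelyi : M.IsStrictlyBelyiType X
  /-- Rmk 3.7.1/3.3.1: `k` is generalized sub-`p`-adic (so `([X],[k],Σ) ∈ 𝒟`, Ex 4.8 (i)) -/
  generalizedSubpadic : ∃ (p : ℕ) (_ : Fact p.Prime), AbsTopIII.IsGeneralizedSubpadicFor (M.base X) p
  /-- "`G` a slim profinite group" -/
  slim : IsSlimGroup (M.ext X).gal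
  /-- "for some `l ∈ Σ`, the cyclotomic character `G → ℤ_l^×` has open image" -/
  cyclotomicallyFull : ∃ (l : ℕ) (_ : Fact l.Prime),
    IsOpen (Set.range (AbsTopIII.cyclotomicChar (M.base X) l))

/-- **Corollary 3.7** pp. 72–73 with Rmk 3.7.1, EXISTENCE OF THE OUTPUT SHAPE in shape (M): for
`X` satisfying the hypotheses, "for every nonempty open subscheme `U_X ⊆ X` defined over a number
field, the natural surjection `Π_{U_X} ↠ Π` [...] may be constructed via group-theoretic operations
as follows (a)(b)(c)": some `BelyiCuspidalization` of `π₁(X) ↠ G_k` has output isomorphic over `Π`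
to `π₁(U_X) ↠ π₁(X)`, with (c) the same decomposition groups of removed points.  HONEST SCOPE: as
long as the `Π`-chain of (a) is recorded by its type-chain only (`chainParams` unconstrained —
TODO-import abc-iut-L4-t4 `PiChain`), this statement carries the SHAPE of the output and the
centre-freeness behind (b), NOT the group-theoreticity of (a); the bi-anabelian CONTENT of
Belyi cuspidalization is `Cor_3_8` below (the "Grothendieck Conjecture-style consequence", p. 74).
[cite: MochizukiAbsTopII2013, Cor 3.7 pp.72-73] -/
def Cor_3_7 : Prop :=
  ∀ (X : M.Curve), M.IsCor37Input X → ∀ U : M.Open X,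
    ∃ B : BelyiCuspidalization (M.ext X), B.cusp.IsoOver (M.cuspOf U) ∧
      B.cusp.decompositionImages B.cusps = (M.cuspOf U).decompositionImages (M.cuspsOf U)

/-- **Corollary 3.8** p. 74 (Profinite Belyi Cuspidalization II: Comparison), in shape (M) with
Rmk 3.7.1's `𝒟`: for `X₁, X₂` satisfying the hypotheses and "`φ : Π₁ ≅ Π₂` an isomorphism of
profinite groups such that `φ(Δ₁) = Δ₂`", "for each nonempty open subscheme `U_{X₁} ⊆ X₁` defined
over a number field, there exist a nonempty open subscheme `U_{X₂} ⊆ X₂` defined over a number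
field and an isomorphism of profinite groups `φ_U : Π_{U_{X₁}} ≅ Π_{U_{X₂}}` that is compatible
with `φ`, relative to the natural surjections `Π_{U_{X_i}} ↠ Π_i`. Moreover, such an isomorphism
`φ_U` is unique up to composition with an inner automorphism arising from an element of the kernel
of `Π_{U_{X_i}} ↠ Π_i`."  Hypotheses: each `X_i` as in Cor 3.7 / Rmk 3.7.1 (`IsCor37Input`) AND
"for some `l ∈ Σ₁ ∩ Σ₂`, the cyclotomic characters `G_i → ℤ_l^×` have open image for `i = 1, 2`"
— ONE COMMON prime `l` for both curves (p. 74; the per-curve clause of `IsCor37Input` does not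
suffice: over `Frac W(𝔽̄_{p_i})` only `l = p_i` works). [cite: MochizukiAbsTopII2013, Cor 3.8 p.74] -/
def Cor_3_8 : Prop :=
  ∀ (X₁ X₂ : M.Curve), M.IsCor37Input X₁ → M.IsCor37Input X₂ →
    (∃ (l : ℕ) (_ : Fact l.Prime), IsOpen (Set.range (AbsTopIII.cyclotomicChar (M.base X₁) l)) ∧
      IsOpen (Set.range (AbsTopIII.cyclotomicChar (M.base X₂) l))) →
    ∀ φ : (M.ext X₁).arith ≃ₜ* (M.ext X₂).arith,
      (M.ext X₁).geom.map φ.toMonoidHom = (M.ext X₂).geom →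
      ∀ U₁ : M.Open X₁, ∃ U₂ : M.Open X₂,
        (∃ φU : (M.cuspOf U₁).ext.arith ≃ₜ* (M.cuspOf U₂).ext.arith,
          ∀ x, (M.cuspOf U₂).hom.arith (φU x) = φ ((M.cuspOf U₁).hom.arith x)) ∧
        ∀ φU φU' : (M.cuspOf U₁).ext.arith ≃ₜ* (M.cuspOf U₂).ext.arith,
          (∀ x, (M.cuspOf U₂).hom.arith (φU x) = φ ((M.cuspOf U₁).hom.arith x)) →
          (∀ x, (M.cuspOf U₂).hom.arith (φU' x) = φ ((M.cuspOf U₁).hom.arith x)) →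
            ∃ g : (M.cuspOf U₂).ext.arith, (M.cuspOf U₂).hom.arith g = 1 ∧
              ∀ x, φU' x = g * φU x * g⁻¹

/-- Cor 3.8 for the identity `φ = id` of ONE curve yields, for each `U₁`, an open `U₂` with
isomorphic cuspidalization (in the model, `U₂ = U₁` qualifies: sanity consequence, PROVED from
`Cor_3_8`). [cite: MochizukiAbsTopII2013, Cor 3.8 p.74] -/
theorem Cor_3_8.self_iso {M : BelyiCurveModel.{u}} (h : M.Cor_3_8) (X : M.Curve)
    (hX : M.IsCor37Input X) (U₁ : M.Open X) :
    ∃ U₂ : M.Open X, (M.cuspOf U₁).IsoOver (M.cuspOf U₂) := by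
  obtain ⟨l, hl, hopen⟩ := hX.cyclotomicallyFull
  obtain ⟨U₂, ⟨φU, hφU⟩, -⟩ := h X X hX hX ⟨l, hl, hopen, hopen⟩ (ContinuousMulEquiv.refl _) (by
    ext x
    simp only [Subgroup.mem_map]
    constructor
    · rintro ⟨y, hy, rfl⟩; exact hy
    · exact fun hx => ⟨x, hx, rfl⟩) U₁
  exact ⟨U₂, φU, fun x => hφU x⟩

end BelyiCurveModel

/-! ### Remarks 3.7.1, 3.7.2 -/

/-! ### Remark 3.7.1 (p. 73) — folded into the hypotheses
`Rmk_3_7_1 : recorded.`  "Similar remarks to Remarks 3.3.1, 3.3.2, 3.3.3 may be made for Corollary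
3.7": Rmk 3.3.1 (`𝒟 :=` orbicurves × generalized sub-`p`-adic fields × (`Σ ∋ p`) satisfies the
`𝒟`-hypothesis, "cf. [AbsTopI] Example 4.8 (i)") is the field `IsCor37Input.generalizedSubpadic`;
Rmk 3.3.2 (MLF/NF: single group `Π`) is `Rmk_3_3_2`; Rmk 3.3.3 (tempered version) is recorded in
`EllipticCuspidalization.lean`. [cite: MochizukiAbsTopII2013, Rmk 3.7.1 p.73] -/

/-! ### Remark 3.7.2 (pp. 73–74) — recorded, no claim typed
`Rmk_3_7_2 : recorded.`  "when the field `k` is an MLF, one then obtains an algorithm for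
constructing the decomposition groups of arbitrary closed points of `X`, by combining the algorithms
of Corollary 3.7 [...] with the '`p`-adic approximation lemma' of [GalSect], Lemma 3.1.  A
'Grothendieck Conjecture-style' version [...] may be found in [GalSect], Corollary 3.2."  [GalSect]
Lem 3.1 / Cor 3.2 are in no L4 slice (LC1-CHAIN M3). [cite: MochizukiAbsTopII2013, Rmk 3.7.2 p.73] -/

end Literature.AnabelianGeometry.AbsoluteAnabelian.AbsTopII
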